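import Mathlib
import HarnessLib
import Summits.RiemannHypothesis.RiemannHypothesis.Theorems.IntegerScrewPsiDeriv
import Summits.RiemannHypothesis.RiemannHypothesis.Theorems.IntegerScrewPsiSmallArgPieces

/-!
# Route `IntegerScrew` — small-argument expansion of Suzuki's `Ψ` with an explicit two-sided remainder

For `0 < u ≤ 1/2`:
`u³/288 + u⁴/48 − u⁵/16000 − u⁶/4800 ≤ Ψ(u) − (−(u log u)/2 + βu + (7/8)u²) ≤ u³/288 + (3/128)u⁴ + u⁵/64000 + (17/72000)u⁶`,
`β = zetaScrewSlope = log 2 + π/4 + 1/2 − (γ₀ + π/2 + 3 log 2 + log π)/2 = (1 − γ₀ − log 2π)/2`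
(`zetaScrew_smallArg_bounds`).  Proof: `Ψ(0) = 0` (`zetaScrew_zero`), the closed form of `Ψ'` on `(0, log 2)`
(`hasDerivAt_zetaScrew`, `IntegerScrewPsiDeriv`) decomposes as `−(log s)/2 + (β − ½) + (7/4)s + f₁ + f₃ + f₂` (`zetaScrewDeriv_eq_pieces`)
with the elementary piece bounds (`IntegerScrewPsiSmallArgPieces` for `f₁`, `f₃`; the arctangent piece
`f₂(s) = arctan(e^{−s/2}) − π/4 + s/4 ∈ [0, s³/96 + s⁵/6000]` here: `f₂' = (c − 2)/(4c)`, `c = e^{s/2} + e^{−s/2}`), and `Ψ − main ∓ envelope` is monotone /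
antitone on `[0, 1/2]` (`monotoneOn_of_deriv_nonneg`).  ELEMENTARY: no Bernoulli-polynomial / digamma /
Hurwitz theory (the upper `u⁴` coefficient `3/128` is the true Taylor coefficient).  Used by the kernel
certificate of the top-block pairing negativity for `N ≥ 129` (SCREW column, rh-explicit cell).  Nothing here
bears on the truth of RH.  References: M. Suzuki, J. Lond. Math. Soc. (2) 108 (2023), (1.1) [Suzuki2023];
[folklore].
-/

set_option linter.dupNamespace false
set_option autoImplicit false

noncomputable section

open scoped Topology BigOperators
open Real Filter Set

namespace Summit.RiemannHypothesis.RiemannHypothesis.Theorems.IntegerScrew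

open Literature.NumberTheory.LFunctions

/-! ### The arctangent piece `f₂(s) = arctan(e^{−s/2}) − π/4 + s/4` -/

/-- The arctangent piece of `Ψ'` with its constant and linear Taylor terms removed. [folklore] -/
def atanPiece (s : ℝ) : ℝ := Real.arctan (Real.exp (-(s / 2))) - Real.pi / 4 + s / 4

/-- Its derivative `1/4 − w/(2(1+w²))`, `w = e^{−s/2}`. [folklore] -/
def atanPieceDeriv (s : ℝ) : ℝ :=
  1 / 4 - Real.exp (-(s / 2)) / (2 * (1 + Real.exp (-(s / 2)) ^ 2))

/-- `f₂(0) = 0` (`arctan 1 = π/4`). [folklore] -/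
theorem atanPiece_zero : atanPiece 0 = 0 := by
  simp [atanPiece, Real.arctan_one]

/-- The derivative of the arctangent piece. [folklore] -/
theorem hasDerivAt_atanPiece (s : ℝ) : HasDerivAt atanPiece (atanPieceDeriv s) s := by
  have hw : HasDerivAt (fun y : ℝ => Real.exp (-(y / 2))) (Real.exp (-(s / 2)) * -(1 / 2)) s := by
    have h := ((hasDerivAt_id s).div_const 2).neg.exp
    simp only [id] at h
    exact h
  have ha := (Real.hasDerivAt_arctan (Real.exp (-(s / 2)))).comp s hw
  have hl : HasDerivAt (fun y : ℝ => y / 4) (1 / 4) s := by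
    have h := (hasDerivAt_id s).div_const 4
    simp only [id] at h
    exact h
  have h := (ha.sub_const (Real.pi / 4)).add hl
  have hfun : atanPiece = fun y => ((Real.arctan ∘ fun y : ℝ => Real.exp (-(y / 2))) y - Real.pi / 4) + y / 4 := by
    funext y; simp [atanPiece, Function.comp_apply]
  rw [hfun]
  refine (h.congr_of_eventuallyEq (Filter.Eventually.of_forall fun y => ?_)).congr_deriv ?_
  · simp only [Pi.add_apply, Function.comp_apply]
  · unfold atanPieceDeriv
    have hpos : 0 < 1 + Real.exp (-(s / 2)) ^ 2 := by positivity
    field_simp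
    ring

/-- Continuity of the arctangent piece. [folklore] -/
theorem continuous_atanPiece : Continuous atanPiece :=
  continuous_iff_continuousAt.2 fun s => (hasDerivAt_atanPiece s).continuousAt

/-- `0 ≤ f₂'(s) ≤ s²/32 + s⁴/1200` for `0 ≤ s ≤ 2`. [folklore] -/
theorem atanPieceDeriv_bounds {s : ℝ} (h0 : 0 ≤ s) (h2 : s ≤ 2) :
    0 ≤ atanPieceDeriv s ∧ atanPieceDeriv s ≤ s ^ 2 / 32 + s ^ 4 / 1200 := by
  set w := Real.exp (-(s / 2)) with hw
  set c := Real.exp (s / 2) + Real.exp (-(s / 2)) with hc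
  have hw0 : 0 < w := Real.exp_pos _
  have hprod : Real.exp (s / 2) * w = 1 := by rw [hw, ← Real.exp_add]; simp
  have hcw : c * w = 1 + w ^ 2 := by rw [hc, add_mul, hprod]; ring
  have hx : |s / 2| ≤ 1 := by rw [abs_of_nonneg (by linarith)]; linarith
  obtain ⟨hc2, hc4⟩ := exp_add_exp_neg_sub_two_bounds hx
  have hc2' : 2 ≤ c := by rw [hc]; linarith
  -- rewrite the derivative as `1/4 − 1/(2c)`
  have hD : atanPieceDeriv s = 1 / 4 - 1 / (2 * c) := by
    unfold atanPieceDeriv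
    rw [← hw, ← hcw]
    field_simp
  rw [hD]
  constructor
  · rw [sub_nonneg, div_le_div_iff₀ (by positivity) (by positivity)]; linarith
  · -- `1/4 − 1/(2c) = (c−2)/(4c) ≤ (c−2)/8 ≤ (s²/4 + 5 s⁴/768)/8`
    have hcpos : 0 < c := by linarith
    have h1 : 1 / 4 - 1 / (2 * c) ≤ (c - 2) / 8 := by
      rw [div_sub_div _ _ (by norm_num) (by positivity), div_le_div_iff₀ (by positivity) (by norm_num)]
      nlinarith
    have h2' : c - 2 ≤ (s / 2) ^ 2 + 5 / 48 * (s / 2) ^ 4 := by rw [hc]; linarith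
    nlinarith

/-- `0 ≤ f₂(s) ≤ s³/96 + s⁵/6000` for `0 ≤ s ≤ 2`. [folklore] -/
theorem atanPiece_bounds {s : ℝ} (h0 : 0 ≤ s) (h2 : s ≤ 2) :
    0 ≤ atanPiece s ∧ atanPiece s ≤ s ^ 3 / 96 + s ^ 5 / 6000 := by
  have hD : Convex ℝ (Set.Icc (0 : ℝ) 2) := convex_Icc 0 2
  have hint : interior (Set.Icc (0 : ℝ) 2) = Set.Ioo 0 2 := interior_Icc
  constructor
  · have hmono : MonotoneOn atanPiece (Set.Icc (0 : ℝ) 2) := by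
      refine monotoneOn_of_deriv_nonneg hD continuous_atanPiece.continuousOn ?_ ?_
      · intro x _; exact (hasDerivAt_atanPiece x).differentiableAt.differentiableWithinAt
      · intro x hx
        rw [hint] at hx
        rw [(hasDerivAt_atanPiece x).deriv]
        exact (atanPieceDeriv_bounds hx.1.le hx.2.le).1
    have := hmono ⟨le_refl 0, by norm_num⟩ ⟨h0, h2⟩ h0
    rwa [atanPiece_zero] at this
  · set G : ℝ → ℝ := fun x => x ^ 3 / 96 + x ^ 5 / 6000 - atanPiece x with hG
    have hGd : ∀ x, HasDerivAt G (3 * x ^ 2 / 96 + 5 * x ^ 4 / 6000 - atanPieceDeriv x) x := by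
      intro x
      have h1 : HasDerivAt (fun x : ℝ => x ^ 3 / 96) (3 * x ^ 2 / 96) x := by
        have := (hasDerivAt_pow 3 x).div_const 96; simpa using this
      have h2 : HasDerivAt (fun x : ℝ => x ^ 5 / 6000) (5 * x ^ 4 / 6000) x := by
        have := (hasDerivAt_pow 5 x).div_const 6000; simpa using this
      have h := (h1.add h2).sub (hasDerivAt_atanPiece x)
      refine h.congr_of_eventuallyEq (Filter.Eventually.of_forall fun y => ?_)
      simp only [hG, Pi.add_apply, Pi.sub_apply]
    have hGc : Continuous G := continuous_iff_continuousAt.2 fun x => (hGd x).continuousAt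
    have hmono : MonotoneOn G (Set.Icc (0 : ℝ) 2) := by
      refine monotoneOn_of_deriv_nonneg hD hGc.continuousOn ?_ ?_
      · intro x _; exact (hGd x).differentiableAt.differentiableWithinAt
      · intro x hx
        rw [hint] at hx
        rw [(hGd x).deriv]
        have := (atanPieceDeriv_bounds hx.1.le hx.2.le).2
        nlinarith
    have hG0 : G 0 = 0 := by simp [hG, atanPiece_zero]
    have := hmono ⟨le_refl 0, by norm_num⟩ ⟨h0, h2⟩ h0
    rw [hG0] at this
    simp only [hG] at this
    linarith


/-! ### Assembly: the two-sided small-argument expansion of `Ψ` on `(0, 1/2]` -/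

/-- The hyperbolic piece `f₁(s) = 2(e^{s/2} − e^{−s/2}) − 2s`. [folklore] -/
def hypPiece (s : ℝ) : ℝ := 2 * (Real.exp (s / 2) - Real.exp (-(s / 2))) - 2 * s

/-- `s³/12 − s⁵/800 ≤ f₁(s) ≤ s³/12 + s⁵/800` on `[0, 2]`. [folklore] -/
theorem hypPiece_bounds {s : ℝ} (h0 : 0 ≤ s) (h2 : s ≤ 2) :
    s ^ 3 / 12 - s ^ 5 / 800 ≤ hypPiece s ∧ hypPiece s ≤ s ^ 3 / 12 + s ^ 5 / 800 := by
  have h := abs_hypPiece_sub_le h0 h2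
  rw [abs_le] at h
  unfold hypPiece
  constructor <;> linarith [h.1, h.2]

/-- The slope constant `β = log 2 + π/4 + 1/2 − (γ₀ + π/2 + 3 log 2 + log π)/2`
(`= (1 − γ₀ − log 2π)/2 = −0.70754…`) of the small-argument expansion. [folklore] -/
def zetaScrewSlope : ℝ :=
  Real.log 2 + Real.pi / 4 + 1 / 2
    - (Real.eulerMascheroniConstant + Real.pi / 2 + 3 * Real.log 2 + Real.log Real.pi) / 2

/-- The main part `−(u log u)/2 + β u + (7/8) u²` of `Ψ` at small argument. [folklore] -/
def zetaScrewMain (u : ℝ) : ℝ := -(u * Real.log u) / 2 + zetaScrewSlope * u + 7 / 8 * u ^ 2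

/-- Decomposition of the closed-form derivative (`s > 0`):
`Ψ'(s) = −(log s)/2 + (β − 1/2) + (7/4)s + f₁(s) + f₃(s) + f₂(s)`. [folklore] -/
theorem zetaScrewDeriv_eq_pieces (s : ℝ) :
    zetaScrewDeriv s = -(Real.log s) / 2 + (zetaScrewSlope - 1 / 2) + 7 / 4 * s
      + hypPiece s + logPiece s + atanPiece s := by
  unfold zetaScrewDeriv zetaScrewSlope hypPiece logPiece atanPiece
  ring

/-- Upper integrated envelope `∫₀ᵘ U`. -/
private def envU (u : ℝ) : ℝ := u ^ 3 / 288 + 3 / 128 * u ^ 4 + u ^ 5 / 64000 + 17 / 72000 * u ^ 6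
/-- Lower integrated envelope `∫₀ᵘ L`. -/
private def envL (u : ℝ) : ℝ := u ^ 3 / 288 + u ^ 4 / 48 - u ^ 5 / 16000 - u ^ 6 / 4800

/-- Derivative of `envU`. [folklore] -/
private lemma hasDerivAt_envU (u : ℝ) :
    HasDerivAt envU (u ^ 2 / 96 + 3 / 32 * u ^ 3 + u ^ 4 / 12800 + 17 / 12000 * u ^ 5) u := by
  unfold envU
  have h3 := (hasDerivAt_pow 3 u).div_const 288
  have h4 := (hasDerivAt_pow 4 u).const_mul (3 / 128)
  have h5 := (hasDerivAt_pow 5 u).div_const 64000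
  have h6 := (hasDerivAt_pow 6 u).const_mul (17 / 72000)
  have h := ((h3.add h4).add h5).add h6
  refine (h.congr_of_eventuallyEq (Filter.Eventually.of_forall fun y => ?_)).congr_deriv ?_
  · simp only [Pi.add_apply]
  · push_cast; ring

/-- Derivative of `envL`. [folklore] -/
private lemma hasDerivAt_envL (u : ℝ) :
    HasDerivAt envL (u ^ 2 / 96 + u ^ 3 / 12 - u ^ 4 / 3200 - u ^ 5 / 800) u := by
  unfold envL
  have h3 := (hasDerivAt_pow 3 u).div_const 288
  have h4 := (hasDerivAt_pow 4 u).div_const 48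
  have h5 := (hasDerivAt_pow 5 u).div_const 16000
  have h6 := (hasDerivAt_pow 6 u).div_const 4800
  have h := ((h3.add h4).sub h5).sub h6
  refine (h.congr_of_eventuallyEq (Filter.Eventually.of_forall fun y => ?_)).congr_deriv ?_
  · simp only [Pi.add_apply, Pi.sub_apply]
  · push_cast; ring

/-- Derivative of the main part. [folklore] -/
private lemma hasDerivAt_zetaScrewMain {u : ℝ} (hu : u ≠ 0) :
    HasDerivAt zetaScrewMain (-(Real.log u + 1) / 2 + zetaScrewSlope + 7 / 4 * u) u := by
  unfold zetaScrewMain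
  have h1 := ((Real.hasDerivAt_mul_log hu).neg).div_const 2
  have h2 := (hasDerivAt_id u).const_mul zetaScrewSlope
  have h3 := (hasDerivAt_pow 2 u).const_mul (7 / 8)
  have h := (h1.add h2).add h3
  refine (h.congr_of_eventuallyEq (Filter.Eventually.of_forall fun y => ?_)).congr_deriv ?_
  · simp only [Pi.add_apply, Pi.neg_apply, id]
  · norm_num
    ring

/-- Continuity of the main part (Mathlib's `x log x` conventions). [folklore] -/
private lemma continuous_zetaScrewMain : Continuous zetaScrewMain := by
  unfold zetaScrewMain
  have := Real.continuous_mul_log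
  fun_prop

/-- `1/2 < log 2`. [folklore] -/
private lemma half_lt_log_two : (1 : ℝ) / 2 < Real.log 2 := by
  have := Real.log_two_gt_d9; linarith

/-- **Small-argument expansion of Suzuki's `Ψ` with an explicit two-sided remainder**: for
`0 < u ≤ 1/2`,
`u³/288 + u⁴/48 − u⁵/16000 − u⁶/4800 ≤ Ψ(u) − (−(u log u)/2 + βu + (7/8)u²) ≤ u³/288 + (3/128)u⁴ + u⁵/64000 + (17/72000)u⁶`,
`β = zetaScrewSlope`. Proof: `Ψ(0) = 0`, `Ψ' = −(log)/2 + (β − ½) + (7/4)s + f₁ + f₂ + f₃` with the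
elementary bounds on `f₁, f₂, f₃`, and monotonicity on `[0, 1/2]`. [folklore] -/
theorem zetaScrew_smallArg_bounds {u : ℝ} (h0 : 0 < u) (h1 : u ≤ 1 / 2) :
    u ^ 3 / 288 + u ^ 4 / 48 - u ^ 5 / 16000 - u ^ 6 / 4800 ≤ zetaScrew u - zetaScrewMain u ∧
    zetaScrew u - zetaScrewMain u
      ≤ u ^ 3 / 288 + 3 / 128 * u ^ 4 + u ^ 5 / 64000 + 17 / 72000 * u ^ 6 := by
  have hD : Convex ℝ (Set.Icc (0 : ℝ) (1 / 2)) := convex_Icc _ _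
  have hint : interior (Set.Icc (0 : ℝ) (1 / 2)) = Set.Ioo 0 (1 / 2) := interior_Icc
  -- derivative of `Ψ − Main` on `(0, 1/2)`
  have hderiv : ∀ x ∈ Set.Ioo (0 : ℝ) (1 / 2),
      HasDerivAt (fun y => zetaScrew y - zetaScrewMain y) (hypPiece x + logPiece x + atanPiece x) x := by
    intro x hx
    have hx2 : x < Real.log 2 := lt_trans hx.2 half_lt_log_two
    have h := (hasDerivAt_zetaScrew hx.1 hx2).sub (hasDerivAt_zetaScrewMain hx.1.ne')
    refine h.congr_deriv ?_
    rw [zetaScrewDeriv_eq_pieces]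
    ring
  have hcont : Continuous fun y => zetaScrew y - zetaScrewMain y :=
    continuous_zetaScrew.sub continuous_zetaScrewMain
  have hzero : zetaScrew 0 - zetaScrewMain 0 = 0 := by
    simp [zetaScrew_zero, zetaScrewMain]
  have hL : ∀ x ∈ Set.Ioo (0 : ℝ) (1 / 2), HasDerivAt (fun y => zetaScrew y - zetaScrewMain y - envL y)
      (hypPiece x + logPiece x + atanPiece x - (x ^ 2 / 96 + x ^ 3 / 12 - x ^ 4 / 3200 - x ^ 5 / 800)) x :=
    fun x hx => ((hderiv x hx).sub (hasDerivAt_envL x)).congr_of_eventuallyEq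
      (Filter.Eventually.of_forall fun y => by simp only [Pi.sub_apply])
  have hU : ∀ x ∈ Set.Ioo (0 : ℝ) (1 / 2), HasDerivAt (fun y => zetaScrew y - zetaScrewMain y - envU y)
      (hypPiece x + logPiece x + atanPiece x
        - (x ^ 2 / 96 + 3 / 32 * x ^ 3 + x ^ 4 / 12800 + 17 / 12000 * x ^ 5)) x :=
    fun x hx => ((hderiv x hx).sub (hasDerivAt_envU x)).congr_of_eventuallyEq
      (Filter.Eventually.of_forall fun y => by simp only [Pi.sub_apply])
  have hcL : Continuous envL := by unfold envL; fun_prop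
  have hcU : Continuous envU := by unfold envU; fun_prop
  constructor
  · -- lower: `B = (Ψ − Main) − envL` is monotone on `[0, 1/2]`
    have hmono : MonotoneOn (fun y => zetaScrew y - zetaScrewMain y - envL y) (Set.Icc (0:ℝ) (1/2)) := by
      refine monotoneOn_of_deriv_nonneg hD (hcont.sub hcL).continuousOn ?_ ?_
      · intro x hx; rw [hint] at hx
        exact (hL x hx).differentiableAt.differentiableWithinAt
      · intro x hx; rw [hint] at hx
        rw [(hL x hx).deriv]
        have hx2 : x ≤ 2 := by linarith [hx.2]
        have b1 := (hypPiece_bounds hx.1.le hx2).1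
        have b2 := (atanPiece_bounds hx.1.le hx2).1
        have b3 := (logPiece_bounds hx.1 hx2).1
        linarith
    have h := hmono ⟨le_refl 0, by norm_num⟩ ⟨h0.le, h1⟩ h0.le
    simp only [hzero, envL] at h
    norm_num at h
    linarith
  · -- upper: `A = (Ψ − Main) − envU` is antitone on `[0, 1/2]`
    have hanti : AntitoneOn (fun y => zetaScrew y - zetaScrewMain y - envU y) (Set.Icc (0:ℝ) (1/2)) := by
      refine antitoneOn_of_deriv_nonpos hD (hcont.sub hcU).continuousOn ?_ ?_
      · intro x hx; rw [hint] at hx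
        exact (hU x hx).differentiableAt.differentiableWithinAt
      · intro x hx; rw [hint] at hx
        rw [(hU x hx).deriv]
        have hx2 : x ≤ 2 := by linarith [hx.2]
        have b1 := (hypPiece_bounds hx.1.le hx2).2
        have b2 := (atanPiece_bounds hx.1.le hx2).2
        have b3 := (logPiece_bounds hx.1 hx2).2
        linarith
    have h := hanti ⟨le_refl 0, by norm_num⟩ ⟨h0.le, h1⟩ h0.le
    simp only [hzero, envU] at h
    norm_num at h
    linarith

end Summit.RiemannHypothesis.RiemannHypothesis.Theorems.IntegerScrew

end
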